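import Literature.IUT.HodgeTheaters.PMTheatersRemarksA
import Mathlib.Analysis.Complex.Basic
import Literature.Analysis.Complex.ConformalRadiusBoundary

/-!
# [IUTchI] Rmk. 6.12.3 (iii): `w = (z − i)/(z + i)` is a bijection of `ℍ` onto the unit disc (proofs)

Proof-only companion of `PMTheatersRemarksA.lean` (abc-iut cell, layer L5, row W2-L5-03a): the file of
record types [IUTchI] Remark 6.12.3 (iii) p. 176 "the coordinate on the upper half-plane that
determines a biholomorphic isomorphism with the unit disc `w := (z − i)/(z + i)`" through
`Rmk6123.cayley`, `norm_cayley_lt_one` (into the disc), `cayley_I`, `cayley_mulSymm_smul`. Here the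
remaining content of "biholomorphic isomorphism" is PROVED: `cayley` is injective away from `−i`
(`cayley_injOn`), every point of the open unit disc is the image of a point of `ℍ` — namely of
`i(1 + w)/(1 − w)` (`cayley_cayleyInv`, `cayleyInv_im_pos`) — so `z ↦ w` is a BIJECTION
from `ℍ` onto the open unit disc (`cayley_bijective`), and both `w` and its inverse are holomorphic
(complex-differentiable) where defined (`differentiableAt_cayley`, `differentiableAt_cayleyInv`).
Classical; [claim: Mochizuki2012, status: disputed] tags record only that the sentence is [IUTchI]'s.
-/

namespace Literature.IUT.HodgeTheaters

namespace Rmk6123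

open UpperHalfPlane
open scoped ComplexConjugate

/-- `w = (z − i)/(z + i) = 1 − 2i/(z + i)` for `z ≠ −i`. [claim: Mochizuki2012, status: disputed] -/
theorem cayley_eq_one_sub (z : ℂ) (hz : z + Complex.I ≠ 0) :
    cayley z = 1 - 2 * Complex.I / (z + Complex.I) := by
  rw [cayley, eq_sub_iff_add_eq, ← add_div, div_eq_one_iff_eq hz]
  ring

/-- [IUTchI] Rmk. 6.12.3 (iii) p. 176, "biholomorphic isomorphism", injectivity: `w` is injective on
`{z | z ≠ −i}` (in particular on `ℍ`). [claim: Mochizuki2012, status: disputed] -/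
theorem cayley_injOn : Set.InjOn cayley {z : ℂ | z + Complex.I ≠ 0} := by
  intro z₁ h₁ z₂ h₂ h
  rw [Set.mem_setOf_eq] at h₁ h₂
  rw [cayley_eq_one_sub z₁ h₁, cayley_eq_one_sub z₂ h₂, sub_right_inj,
    div_eq_div_iff h₁ h₂, mul_right_inj' (by simp [Complex.ext_iff])] at h
  exact (add_left_inj _).mp h.symm

/-- `w` is injective on the upper half-plane. [claim: Mochizuki2012, status: disputed] -/
theorem cayley_injective_upperHalfPlane :
    Function.Injective fun z : ℍ => cayley (z : ℂ) := by
  intro z₁ z₂ h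
  have := cayley_injOn (coe_add_I_ne_zero z₁) (coe_add_I_ne_zero z₂) h
  exact UpperHalfPlane.ext this

/-- The inverse coordinate is `z = i(1 + w)/(1 − w)` ([IUTchI] Rmk. 6.12.3 (iii) p. 176); its imaginary
part is `(1 − |w|²)/|1 − w|²`. [claim: Mochizuki2012, status: disputed] -/
theorem cayleyInv_im (w : ℂ) :
    (Complex.I * (1 + w) / (1 - w)).im = (1 - Complex.normSq w) / Complex.normSq (1 - w) := by
  rw [Complex.div_im, ← sub_div]
  congr 1
  simp only [Complex.mul_re, Complex.mul_im, Complex.I_re, Complex.I_im, Complex.add_re,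
    Complex.add_im, Complex.one_re, Complex.one_im, Complex.sub_re, Complex.sub_im, zero_mul,
    one_mul, zero_add, zero_sub, Complex.normSq_apply]
  ring

/-- [IUTchI] Rmk. 6.12.3 (iii) p. 176: the inverse coordinate carries the open unit disc into the
upper half-plane. [claim: Mochizuki2012, status: disputed] -/
theorem cayleyInv_im_pos {w : ℂ} (hw : ‖w‖ < 1) : 0 < (Complex.I * (1 + w) / (1 - w)).im := by
  rw [cayleyInv_im]
  apply div_pos
  · rw [sub_pos, Complex.normSq_eq_norm_sq]
    exact pow_lt_one₀ (norm_nonneg _) hw two_ne_zero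
  · exact Complex.normSq_pos.mpr (Literature.Analysis.Complex.one_sub_ne_zero_of_norm_lt_one hw)

/-- `w(i(1 + w)/(1 − w)) = w` for `w ≠ 1`. [claim: Mochizuki2012, status: disputed] -/
theorem cayley_cayleyInv {w : ℂ} (hw : (1 : ℂ) - w ≠ 0) :
    cayley (Complex.I * (1 + w) / (1 - w)) = w := by
  have hI : Complex.I ≠ 0 := Complex.I_ne_zero
  have h2 : Complex.I * (1 + w) / (1 - w) + Complex.I = 2 * Complex.I / (1 - w) := by
    rw [div_add' _ _ _ hw, eq_div_iff hw, div_mul_cancel₀ _ hw]; ring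
  have h1 : Complex.I * (1 + w) / (1 - w) - Complex.I = 2 * Complex.I * w / (1 - w) := by
    rw [div_sub' hw, eq_div_iff hw, div_mul_cancel₀ _ hw]; ring
  rw [cayley, h1, h2, div_div_div_cancel_right₀ hw, mul_comm (2 * Complex.I) w, mul_div_assoc,
    div_self (mul_ne_zero two_ne_zero hI), mul_one]

/-- **[IUTchI] Rmk. 6.12.3 (iii) p. 176**, "determines a biholomorphic ISOMORPHISM with the unit disc":
`z ↦ w = (z − i)/(z + i)` is a bijection from the upper half-plane onto the open unit disc (PROVED;
with `norm_cayley_lt_one` of the statement file). [claim: Mochizuki2012, status: disputed] -/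
theorem cayley_bijective :
    Function.Bijective fun z : ℍ =>
      (⟨cayley (z : ℂ), mem_ball_zero_iff.mpr (norm_cayley_lt_one z)⟩ : Metric.ball (0 : ℂ) 1) := by
  constructor
  · intro z₁ z₂ h
    exact cayley_injective_upperHalfPlane (congrArg Subtype.val h)
  · intro w
    refine ⟨⟨Complex.I * (1 + (w : ℂ)) / (1 - w), cayleyInv_im_pos (mem_ball_zero_iff.mp w.2)⟩,
      Subtype.ext ?_⟩
    exact cayley_cayleyInv (Literature.Analysis.Complex.one_sub_ne_zero_of_norm_lt_one (mem_ball_zero_iff.mp w.2))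

/-- [IUTchI] Rmk. 6.12.3 (iii) p. 176, "biholomorphic": `w` is complex-differentiable at every `z ≠ −i`
(so on all of `ℍ`). [claim: Mochizuki2012, status: disputed] -/
theorem differentiableAt_cayley {z : ℂ} (hz : z + Complex.I ≠ 0) : DifferentiableAt ℂ cayley z := by
  have : cayley = fun z => (z - Complex.I) / (z + Complex.I) := rfl
  rw [this]
  exact ((differentiableAt_id.sub_const _).div (differentiableAt_id.add_const _) hz)

/-- [IUTchI] Rmk. 6.12.3 (iii) p. 176, "biholomorphic": the inverse coordinate is complex-differentiable
at every `w ≠ 1` (so on all of the open unit disc). [claim: Mochizuki2012, status: disputed] -/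
theorem differentiableAt_cayleyInv {w : ℂ} (hw : (1 : ℂ) - w ≠ 0) :
    DifferentiableAt ℂ (fun w : ℂ => Complex.I * (1 + w) / (1 - w)) w := by
  exact ((differentiableAt_const _).mul (differentiableAt_id.const_add _)).div
    ((differentiableAt_const _).sub differentiableAt_id) hw

end Rmk6123

end Literature.IUT.HodgeTheaters
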